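import Mathlib.NumberTheory.NumberField.Discriminant.Defs
import Mathlib.FieldTheory.IsAlgClosed.AlgebraicClosure
import Mathlib.FieldTheory.Fixed
import Mathlib.GroupTheory.SpecificGroups.Alternating
import HarnessLib

/-!
# The square root of the discriminant inside a normal closure, and the Galois action on it

Topic `NumberTheory/NumberFields`.  Theorem-only file (no definition, no named fact, D-0026),
Mathlib only.  The classical remark behind the quadratic resolvent of a cubic (and, generally,
behind `ℚ(√d_F) ⊆` Galois closure of `F`): if `σ₁, …, σₙ : F → L` are ALL the embeddings of the
number field `F` into a field `L` (e.g. `L` a Galois extension of `ℚ` containing `F`) and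
`x₁, …, xₙ` is an integral basis, then `δ = det(σⱼ(xᵢ)) ∈ L` satisfies `δ² = d_F`
(Ash, *A Course in Algebraic Number Theory*, (2.3.3): "`D(x₁, …, xₙ) = [det(σᵢ(xⱼ))]²`"), and an
automorphism `τ` of `L` permutes the embeddings, hence the columns of the matrix, so `τ(δ) = ±δ`
(the sign of that permutation).  Consequently `δ` is fixed by every automorphism of odd order, so
`δ` lies in the fixed field of any subgroup of odd order — for an `S₃`-closure `L` of a non-cyclic
cubic field `F`, `δ` lies in the quadratic resolvent field `L^{A₃}`, i.e. `ℚ(√d_F)` is the quadratic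
subfield (Marcus, *Number Fields*, Ch. 2, Exercise 8 ff.; Cohen, *A Course in Computational
Algebraic Number Theory*, §6.3.3).

* `exists_perm_hom_det_sq_eq_discr` — with `#(F →ₐ[ℚ] L) = [F : ℚ]`: there are `δ : L` with
  `δ² = d_F` and the permutation representation `ρ : Aut(L/ℚ) → 𝔖(F →ₐ[ℚ] L)`, `ρ(τ)(σ) = τ ∘ σ`,
  with `τ δ = sign(ρ τ) · δ` for every `τ`;
* `exists_det_sq_eq_discr` — in particular `τ δ = δ ∨ τ δ = −δ`;
* `smul_eq_self_of_odd_orderOf` — such a `δ ≠ 0` is fixed by every `τ` of odd order;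
* `exists_sq_eq_discr_mem_fixedField` — hence `δ ∈ L^H` for every subgroup `H ≤ Aut(L/ℚ)` of odd
  order, with `δ² = d_F`, `δ ≠ 0`;
* `algEquiv_eq_one_of_forall_comp_eq` — if the conjugates `σ(F)` generate `L`, an automorphism
  fixing every embedding is trivial (the permutation representation is faithful);
* `exists_sq_eq_discr_mem_fixedField_not_mem_range` — if moreover `[F:ℚ]! < 2 · #Aut(L/ℚ)` (the
  faithful image cannot lie in the alternating group), some `τ` has `τ δ = −δ`, so `δ ∉ ℚ`: for the
  `S₃`-closure of a non-cyclic cubic `F`, `δ = √d_F` generates the quadratic resolvent field.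

## References

* R. B. Ash, *A Course in Algebraic Number Theory*, Dover 2010, §2.3 (2.3.3) and Problems 1–3 (held
  copy `book:ash2010-course-algebraic-number-theory`, PDF p. 19). [Ash2010]
* D. A. Marcus, *Number Fields*, 2nd ed., Springer 2018, Ch. 2 (discriminants and embeddings).
  [Marcus2018]
-/

noncomputable section

open NumberField Matrix Module
open scoped Classical

namespace Literature.NumberTheory.NumberFields

/-- **`√d_F` and the permutation representation on the embeddings.**  Let `F` be a number field and
`L` a field over `ℚ` admitting `[F : ℚ]` embeddings `F → L`.  Then there are `δ ∈ L` (the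
determinant `det(σⱼ(xᵢ))` on an integral basis) with `δ² = d_F`, and the permutation representation
`ρ` of `Aut(L/ℚ)` on the embeddings, `ρ(τ)(σ) = τ ∘ σ`, such that `τ δ = sign(ρ τ) · δ` for every
`τ` (an automorphism permutes the embeddings, i.e. the columns of the matrix).
[cite: Ash2010, §2.3 (2.3.3) and Problem 1 (PDF p. 19)] -/
theorem exists_perm_hom_det_sq_eq_discr (F : Type*) [Field F] [NumberField F] (L : Type*) [Field L]
    [Algebra ℚ L] [Algebra.IsAlgebraic ℚ L]
    (hcard : Fintype.card (F →ₐ[ℚ] L) = finrank ℚ F) :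
    ∃ (δ : L) (ρ : (L ≃ₐ[ℚ] L) →* Equiv.Perm (F →ₐ[ℚ] L)),
      δ ^ 2 = ((discr F : ℤ) : L) ∧ (∀ τ σ, ρ τ σ = τ.toAlgHom.comp σ) ∧
      ∀ τ : L ≃ₐ[ℚ] L, τ δ = ((Equiv.Perm.sign (ρ τ) : ℤ) : L) * δ := by
  classical
  -- an algebraically closed field over `L`, where Mathlib's `discr = det²` is available
  set Ω := AlgebraicClosure ℚ with hΩ
  haveI : CharZero L := charZero_of_injective_algebraMap (algebraMap ℚ L).injective
  set j : L →ₐ[ℚ] Ω := IsAlgClosed.lift with hj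
  have hjinj : Function.Injective j := j.toRingHom.injective
  set ι := Free.ChooseBasisIndex ℤ (𝓞 F)
  set b := integralBasis F with hb
  -- all embeddings `F → Ω` factor through `L` (both sets have `[F : ℚ]` elements)
  set c : (F →ₐ[ℚ] L) → (F →ₐ[ℚ] Ω) := fun σ => j.comp σ with hc
  have hcinj : Function.Injective c := by
    intro σ σ' h
    ext x
    exact hjinj (by simpa [hc] using congrArg (fun f : F →ₐ[ℚ] Ω => f x) h)
  have hcardΩ : Fintype.card (F →ₐ[ℚ] Ω) = finrank ℚ F := AlgHom.card ℚ F Ω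
  have hcbij : Function.Bijective c := by
    refine (Fintype.bijective_iff_injective_and_card c).mpr ⟨hcinj, ?_⟩
    rw [hcard, hcardΩ]
  have hcardι : Fintype.card ι = Fintype.card (F →ₐ[ℚ] Ω) := by
    rw [hcardΩ, finrank_eq_card_basis b]
  set eΩ : ι ≃ (F →ₐ[ℚ] Ω) := Fintype.equivOfCardEq hcardι with heΩ
  obtain ⟨eL, hce⟩ : ∃ eL : ι ≃ (F →ₐ[ℚ] L), ∀ k, c (eL k) = eΩ k :=
    ⟨eΩ.trans (Equiv.ofBijective c hcbij).symm, fun k =>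
      Equiv.ofBijective_apply_symm_apply c hcbij (eΩ k)⟩
  -- the matrix over `L` and its image over `Ω`
  set M : Matrix ι ι L := Matrix.of fun i k => eL k (b i) with hM
  have hMap : j.toRingHom.mapMatrix M = Algebra.embeddingsMatrixReindex ℚ Ω b eΩ := by
    ext i k
    change j (M i k) = (eΩ k) (b i)
    rw [← hce k]
    rfl
  -- `δ = det M` has `δ² = d_F`
  have hdisc : algebraMap ℚ Ω (discr F : ℚ) = (j M.det) ^ 2 := by
    rw [coe_discr, Algebra.discr_eq_det_embeddingsMatrixReindex_pow_two ℚ Ω b eΩ, ← hMap]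
    congr 1
    exact (RingHom.map_det j.toRingHom M).symm
  -- the permutation representation on the embeddings
  set ρ : (L ≃ₐ[ℚ] L) →* Equiv.Perm (F →ₐ[ℚ] L) :=
    { toFun := fun τ => AlgEquiv.arrowCongr AlgEquiv.refl τ
      map_one' := by
        ext σ x
        rfl
      map_mul' := fun τ τ' => by
        ext σ x
        rfl } with hρdef
  have hρ : ∀ τ σ, ρ τ σ = τ.toAlgHom.comp σ := by
    intro τ σ
    change AlgEquiv.arrowCongr AlgEquiv.refl τ σ = _
    rw [AlgEquiv.arrowCongr_apply]
    ext x
    rfl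
  refine ⟨M.det, ρ, ?_, hρ, ?_⟩
  · apply hjinj
    have h1 : j (((discr F : ℤ) : L)) = algebraMap ℚ Ω (discr F : ℚ) := by
      rw [map_intCast, ← map_intCast (algebraMap ℚ Ω) (discr F)]
    rw [map_pow, h1, hdisc]
  · intro τ
    -- `τ` permutes the embeddings `F → L`, hence the columns of `M`, by `ρι = eL⁻¹ ρ(τ) eL`
    set ρι : Equiv.Perm ι := eL.symm.permCongr (ρ τ) with hρι
    have hρ' : ∀ k, eL (ρι k) = τ.toAlgHom.comp (eL k) := by
      intro k
      rw [hρι, Equiv.permCongr_apply, Equiv.symm_symm, Equiv.apply_symm_apply, hρ]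
    have hτM : τ.toAlgHom.toRingHom.mapMatrix M = M.submatrix id ρι := by
      ext i k
      change τ (M i k) = M i (ρι k)
      simp only [hM, Matrix.of_apply, hρ']
      rfl
    have hdet : τ M.det = ((Equiv.Perm.sign ρι : ℤ) : L) * M.det := by
      have h := RingHom.map_det τ.toAlgHom.toRingHom M
      rw [hτM, Matrix.det_permute'] at h
      exact h
    rw [hdet, hρι, Equiv.Perm.sign_permCongr]

/-- **`√d_F` in a field receiving all the embeddings of `F`, and the Galois action on it.**  Let `F`
be a number field and `L` a field over `ℚ` admitting `[F : ℚ]` embeddings `F → L`.  Then there is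
`δ ∈ L` (the determinant `det(σⱼ(xᵢ))` on an integral basis) with `δ² = d_F`, and every
`ℚ`-automorphism `τ` of `L` satisfies `τ δ = δ` or `τ δ = −δ` (it permutes the embeddings, i.e. the
columns). [cite: Ash2010, §2.3 (2.3.3) and Problem 1 (PDF p. 19)] -/
theorem exists_det_sq_eq_discr (F : Type*) [Field F] [NumberField F] (L : Type*) [Field L]
    [Algebra ℚ L] [Algebra.IsAlgebraic ℚ L]
    (hcard : Fintype.card (F →ₐ[ℚ] L) = finrank ℚ F) :
    ∃ δ : L, δ ^ 2 = ((discr F : ℤ) : L) ∧ ∀ τ : L ≃ₐ[ℚ] L, τ δ = δ ∨ τ δ = -δ := by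
  obtain ⟨δ, ρ, hsq, -, hτ⟩ := exists_perm_hom_det_sq_eq_discr F L hcard
  refine ⟨δ, hsq, fun τ => ?_⟩
  rcases Int.units_eq_one_or (Equiv.Perm.sign (ρ τ)) with h | h
  · left
    rw [hτ, h, Units.val_one, Int.cast_one, one_mul]
  · right
    rw [hτ, h, Units.val_neg, Units.val_one, Int.cast_neg, Int.cast_one, neg_one_mul]

/-- **An element sent to `±` itself by every automorphism is fixed by the automorphisms of odd
order** (if `τ δ = −δ` then `τᵏ δ = (−1)ᵏ δ`, and `τᵐ = 1` with `m` odd forces `δ = −δ`, i.e.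
`δ = 0` in characteristic `0`). [folklore] -/
theorem smul_eq_self_of_odd_orderOf {L : Type*} [Field L] [Algebra ℚ L] {δ : L} (hδ : δ ≠ 0)
    {τ : L ≃ₐ[ℚ] L} (hτ : τ δ = δ ∨ τ δ = -δ) (hodd : Odd (orderOf τ)) : τ δ = δ := by
  haveI : CharZero L := charZero_of_injective_algebraMap (algebraMap ℚ L).injective
  rcases hτ with h | h
  · exact h
  · exfalso
    have hpow : ∀ k : ℕ, (τ ^ k) δ = (-1) ^ k * δ := by
      intro k
      induction k with
      | zero => simp
      | succ k ih =>
        rw [pow_succ', AlgEquiv.mul_apply, ih, map_mul, map_pow, map_neg, map_one, h]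
        ring
    have h1 := hpow (orderOf τ)
    rw [pow_orderOf_eq_one, AlgEquiv.one_apply, hodd.neg_one_pow, neg_one_mul] at h1
    have h2 : (2 : L) * δ = 0 := by linear_combination h1
    exact hδ ((mul_eq_zero.mp h2).resolve_left two_ne_zero)

/-- **`√d_F` lies in the fixed field of every subgroup of odd order.**  With `#(F →ₐ[ℚ] L) = [F:ℚ]`
and `H ≤ Aut(L/ℚ)` of odd order, there is `δ ∈ L^H`, `δ ≠ 0`, with `δ² = d_F` — e.g. for the
`S₃`-closure `L` of a non-cyclic cubic field `F` and `H = A₃ = Gal(L/K₂)`: `√d_F` lies in the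
quadratic resolvent field `K₂`. [cite: Ash2010, §2.3 (2.3.3) and Problem 1 (PDF p. 19)] -/
theorem exists_sq_eq_discr_mem_fixedField (F : Type*) [Field F] [NumberField F] (L : Type*)
    [Field L] [Algebra ℚ L] [Algebra.IsAlgebraic ℚ L]
    (hcard : Fintype.card (F →ₐ[ℚ] L) = finrank ℚ F)
    (H : Subgroup (L ≃ₐ[ℚ] L)) (hH : Odd (Nat.card H)) :
    ∃ δ : L, δ ∈ IntermediateField.fixedField H ∧ δ ≠ 0 ∧ δ ^ 2 = ((discr F : ℤ) : L) := by
  haveI : CharZero L := charZero_of_injective_algebraMap (algebraMap ℚ L).injective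
  obtain ⟨δ, hsq, hτ⟩ := exists_det_sq_eq_discr F L hcard
  have hδ : δ ≠ 0 := by
    intro h0
    rw [h0, zero_pow two_ne_zero, eq_comm, Int.cast_eq_zero] at hsq
    exact discr_ne_zero F hsq
  refine ⟨δ, ?_, hδ, hsq⟩
  rw [IntermediateField.mem_fixedField_iff]
  intro τ hτH
  have hodd : Odd (orderOf τ) := by
    have hdvd : orderOf (⟨τ, hτH⟩ : H) ∣ Nat.card H := orderOf_dvd_natCard _
    rw [Subgroup.orderOf_mk] at hdvd
    exact hH.of_dvd_nat hdvd
  exact smul_eq_self_of_odd_orderOf hδ (hτ τ) hodd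


/-! ### When the conjugates of `F` generate `L`: faithfulness, and `√d_F ∉ ℚ` -/

/-- **The permutation representation is faithful when the conjugates generate**: if
`L = ⋁_σ σ(F)` over all embeddings `σ : F → L` and `τ ∘ σ = σ` for every `σ`, then `τ = 1`
(`τ` fixes each `σ(F)`, hence their compositum). [folklore] -/
theorem algEquiv_eq_one_of_forall_comp_eq {F : Type*} [Field F] [Algebra ℚ F] {L : Type*} [Field L]
    [Algebra ℚ L] (hgen : ⨆ σ : F →ₐ[ℚ] L, σ.fieldRange = ⊤) {τ : L ≃ₐ[ℚ] L}
    (h : ∀ σ : F →ₐ[ℚ] L, τ.toAlgHom.comp σ = σ) : τ = 1 := by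
  have hle : (⊤ : IntermediateField ℚ L) ≤
      IntermediateField.fixedField (Subgroup.zpowers τ) := by
    rw [← hgen, iSup_le_iff]
    intro σ
    rintro _ ⟨x, rfl⟩
    rw [IntermediateField.mem_fixedField_iff]
    intro g hg
    obtain ⟨k, rfl⟩ := Subgroup.mem_zpowers_iff.mp hg
    -- `τ` fixes `σ x`, hence so does every power
    have h1 : τ (σ x) = σ x := by
      have := congrArg (fun f : F →ₐ[ℚ] L => f x) (h σ)
      simpa using this
    have hnat : ∀ n : ℕ, (τ ^ n) (σ x) = σ x := by
      intro n
      induction n with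
      | zero => simp
      | succ n ih => rw [pow_succ, AlgEquiv.mul_apply, h1, ih]
    rcases Int.eq_nat_or_neg k with ⟨n, rfl | rfl⟩
    · rw [zpow_natCast]; exact hnat n
    · rw [zpow_neg, zpow_natCast]
      apply (τ ^ n).injective
      rw [← AlgEquiv.mul_apply, mul_inv_cancel, AlgEquiv.one_apply]
      exact (hnat n).symm
  ext x
  have hx : x ∈ IntermediateField.fixedField (Subgroup.zpowers τ) := hle IntermediateField.mem_top
  rw [IntermediateField.mem_fixedField_iff] at hx
  exact hx τ (Subgroup.mem_zpowers τ)

/-- **`√d_F` generates a quadratic subfield when the closure is large.**  With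
`#(F →ₐ[ℚ] L) = [F:ℚ] ≥ 2`, the conjugates of `F` generating `L`, and `[F:ℚ]! < 2 · #Aut(L/ℚ)` (so
that the faithful image of `Aut(L/ℚ)` in `𝔖_{[F:ℚ]}` is not contained in the alternating group):
for every subgroup `H ≤ Aut(L/ℚ)` of odd order there is `δ ∈ L^H` with `δ² = d_F` and `δ ∉ ℚ`
(some `τ` has `τ δ = −δ ≠ δ`).  For a non-cyclic cubic field `F` with `S₃`-closure `L` and
`H = Gal(L/K₂)` this says: `√d_F ∈ K₂ ∖ ℚ`, i.e. the quadratic resolvent field is `ℚ(√d_F)`.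
[cite: Ash2010, §2.3 (2.3.3) and Problem 1 (PDF p. 19)] [cite: Marcus2018, Ch. 2 (discriminants and embeddings)] -/
theorem exists_sq_eq_discr_mem_fixedField_not_mem_range (F : Type*) [Field F] [NumberField F]
    (L : Type*) [Field L] [Algebra ℚ L] [Algebra.IsAlgebraic ℚ L] [Finite (L ≃ₐ[ℚ] L)]
    (hcard : Fintype.card (F →ₐ[ℚ] L) = finrank ℚ F) (h2 : 2 ≤ finrank ℚ F)
    (hgen : ⨆ σ : F →ₐ[ℚ] L, σ.fieldRange = ⊤)
    (hbig : (finrank ℚ F).factorial < 2 * Nat.card (L ≃ₐ[ℚ] L))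
    (H : Subgroup (L ≃ₐ[ℚ] L)) (hH : Odd (Nat.card H)) :
    ∃ δ : L, δ ∈ IntermediateField.fixedField H ∧ δ ^ 2 = ((discr F : ℤ) : L) ∧
      δ ∉ Set.range (algebraMap ℚ L) := by
  classical
  haveI : CharZero L := charZero_of_injective_algebraMap (algebraMap ℚ L).injective
  obtain ⟨δ, ρ, hsq, hρ, hτ⟩ := exists_perm_hom_det_sq_eq_discr F L hcard
  have hδ : δ ≠ 0 := by
    intro h0
    rw [h0, zero_pow two_ne_zero, eq_comm, Int.cast_eq_zero] at hsq
    exact discr_ne_zero F hsq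
  have hpm : ∀ τ : L ≃ₐ[ℚ] L, τ δ = δ ∨ τ δ = -δ := by
    intro τ
    rcases Int.units_eq_one_or (Equiv.Perm.sign (ρ τ)) with h | h
    · left
      rw [hτ, h, Units.val_one, Int.cast_one, one_mul]
    · right
      rw [hτ, h, Units.val_neg, Units.val_one, Int.cast_neg, Int.cast_one, neg_one_mul]
  -- `ρ` is faithful
  have hρinj : Function.Injective ρ := by
    rw [← MonoidHom.ker_eq_bot_iff, Subgroup.eq_bot_iff_forall]
    intro τ hτker
    rw [MonoidHom.mem_ker] at hτker
    refine algEquiv_eq_one_of_forall_comp_eq hgen fun σ => ?_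
    rw [← hρ τ σ, hτker, Equiv.Perm.one_apply]
  -- so its image is too big for the alternating group: some `τ` acts as an odd permutation
  have hodd : ∃ τ : L ≃ₐ[ℚ] L, Equiv.Perm.sign (ρ τ) = -1 := by
    by_contra hall
    simp only [not_exists] at hall
    have hle : ρ.range ≤ alternatingGroup (F →ₐ[ℚ] L) := by
      rintro _ ⟨τ, rfl⟩
      rw [Equiv.Perm.mem_alternatingGroup]
      exact (Int.units_eq_one_or _).resolve_right (hall τ)
    haveI : Nontrivial (F →ₐ[ℚ] L) := by
      rw [← Fintype.one_lt_card_iff_nontrivial, hcard]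
      omega
    have h1 : Nat.card (L ≃ₐ[ℚ] L) = Nat.card ρ.range :=
      Nat.card_congr (MonoidHom.ofInjective hρinj).toEquiv
    have h2' : Nat.card ρ.range ≤ Nat.card (alternatingGroup (F →ₐ[ℚ] L)) :=
      Subgroup.card_le_of_le hle
    have h3 : 2 * Nat.card (alternatingGroup (F →ₐ[ℚ] L)) = (finrank ℚ F).factorial := by
      rw [two_mul_nat_card_alternatingGroup, Nat.card_perm, Nat.card_eq_fintype_card, hcard]
    omega
  obtain ⟨τ₀, hτ₀⟩ := hodd
  have hneg : τ₀ δ = -δ := by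
    rw [hτ, hτ₀, Units.val_neg, Units.val_one, Int.cast_neg, Int.cast_one, neg_one_mul]
  refine ⟨δ, ?_, hsq, ?_⟩
  · rw [IntermediateField.mem_fixedField_iff]
    intro τ hτH
    have hoddτ : Odd (orderOf τ) := by
      have hdvd : orderOf (⟨τ, hτH⟩ : H) ∣ Nat.card H := orderOf_dvd_natCard _
      rw [Subgroup.orderOf_mk] at hdvd
      exact hH.of_dvd_nat hdvd
    exact smul_eq_self_of_odd_orderOf hδ (hpm τ) hoddτ
  · rintro ⟨q, hq⟩
    rw [← hq, AlgEquiv.commutes] at hneg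
    have h2 : (2 : L) * algebraMap ℚ L q = 0 := by linear_combination hneg
    exact hδ (by rw [← hq]; exact (mul_eq_zero.mp h2).resolve_left two_ne_zero)

end Literature.NumberTheory.NumberFields

end
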